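import Summits.CriticalPhenomena.PercolationContinuityZ3.Theorems.PercNearOneGluingNoHeavyLowerTailStarSetTwoWordSupply
import Summits.CriticalPhenomena.PercolationContinuityZ3.Theorems.PercNearOneGluingNoHeavyLowerTailStarSetRegroup
import HarnessLib

/-!
# `NoHeavyLowerTail` (stmt-CriticalPhenomena-4575) — U0' assembly, part 1: the two words of a pair in the TRUE extreme coefficients

Support file (prover `prim-gen-swap` gen 9; `--supports stmt-CriticalPhenomena-4575`).  No definitions, no named facts, no sorries.

Instantiates `StarSet.two_word_supply` with the extreme coefficients of `StarSet.extreme_regroup` (hairs `w(s x, p x)`, `w(s x, p' x)`) and the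
two words of MWF-CERT §5 Step 2 for a pair of adjacent classes sharing the port `q`: star `i` (ports `{q, pK}`), star `j` (ports `{q, sJ}`),
third stars `n ∈ Nst` (ports `{pK, v}`):  `W₁ n = (i→q, j→sJ, n→pK)`, `W₂ n = (i→pK, j→q, n→v)` (all other stars unglued).

* `StarSet.pair_words_supply` — `8 θ_i θ_j · coef(0) ≤ Σ_{n∈Nst} (coef(W₁ n) + coef(W₂ n))` provided `√θ_i ≤ Σ_{n∈Nst} √θ_n`.
-/

noncomputable section

namespace Summit.CriticalPhenomena.PercolationContinuityZ3.Theorems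

open Finset
open scoped BigOperators

namespace StarSet

variable {n m : ℕ}

/-- **The two words of a pair, in the true coefficients.**  See the file header. [MWF-CERT.md §5 Step 2] -/
theorem pair_words_supply (w : Sym2 (Fin n) → unitInterval) (s p p' : Fin m → Fin n) {i j : Fin m} (hij : i ≠ j)
    (Nst : Finset (Fin m)) (hiN : i ∉ Nst) (hjN : j ∉ Nst) (q pK sJ v : Fin n)
    (hpi : (p i = q ∧ p' i = pK) ∨ (p i = pK ∧ p' i = q)) (hpj : (p j = q ∧ p' j = sJ) ∨ (p j = sJ ∧ p' j = q))
    (hpn : ∀ x ∈ Nst, (p x = pK ∧ p' x = v) ∨ (p x = v ∧ p' x = pK)) (hqK : q ≠ pK) (hqJ : q ≠ sJ) (hKv : pK ≠ v)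
    (hS : Real.sqrt ((w s(s i, p i) : ℝ) * w s(s i, p' i)) ≤ ∑ x ∈ Nst, Real.sqrt ((w s(s x, p x) : ℝ) * w s(s x, p' x))) :
    8 * ((w s(s i, p i) : ℝ) * w s(s i, p' i)) * ((w s(s j, p j) : ℝ) * w s(s j, p' j)) *
        ∏ x, (if (w s(s x, p x) : ℝ) * w s(s x, p' x) < 1 then
          ((1 - (w s(s x, p x) : ℝ)) * (1 - w s(s x, p' x))) / (1 - (w s(s x, p x) : ℝ) * w s(s x, p' x)) else 0) ≤
      ∑ nn ∈ Nst,
        ((∏ x, (if (w s(s x, p x) : ℝ) * w s(s x, p' x) < 1 then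
            ((if (if x = i then (if q = p x then (1 : Fin 3) else 2) else if x = j then (if sJ = p x then (1 : Fin 3) else 2)
                  else if x = nn then (if pK = p x then (1 : Fin 3) else 2) else 0) = 1 then (w s(s x, p x) : ℝ) else 1 - w s(s x, p x)) *
              (if (if x = i then (if q = p x then (1 : Fin 3) else 2) else if x = j then (if sJ = p x then (1 : Fin 3) else 2)
                  else if x = nn then (if pK = p x then (1 : Fin 3) else 2) else 0) = 2 then (w s(s x, p' x) : ℝ) else 1 - w s(s x, p' x))) /
              (1 - (w s(s x, p x) : ℝ) * w s(s x, p' x))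
          else if (if x = i then (if q = p x then (1 : Fin 3) else 2) else if x = j then (if sJ = p x then (1 : Fin 3) else 2)
                  else if x = nn then (if pK = p x then (1 : Fin 3) else 2) else 0) = 1 then 1 else 0)) +
         ∏ x, (if (w s(s x, p x) : ℝ) * w s(s x, p' x) < 1 then
            ((if (if x = i then (if pK = p x then (1 : Fin 3) else 2) else if x = j then (if q = p x then (1 : Fin 3) else 2)
                  else if x = nn then (if v = p x then (1 : Fin 3) else 2) else 0) = 1 then (w s(s x, p x) : ℝ) else 1 - w s(s x, p x)) *
              (if (if x = i then (if pK = p x then (1 : Fin 3) else 2) else if x = j then (if q = p x then (1 : Fin 3) else 2)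
                  else if x = nn then (if v = p x then (1 : Fin 3) else 2) else 0) = 2 then (w s(s x, p' x) : ℝ) else 1 - w s(s x, p' x))) /
              (1 - (w s(s x, p x) : ℝ) * w s(s x, p' x))
          else if (if x = i then (if pK = p x then (1 : Fin 3) else 2) else if x = j then (if q = p x then (1 : Fin 3) else 2)
                  else if x = nn then (if v = p x then (1 : Fin 3) else 2) else 0) = 1 then 1 else 0)) := by
  -- abstract coefficients
  set θ : Fin m → ℝ := fun x => (w s(s x, p x) : ℝ) * w s(s x, p' x) with hθ
  set A : Fin m → Fin 3 → ℝ := fun x k => if θ x < 1 then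
      ((if k = 1 then (w s(s x, p x) : ℝ) else 1 - w s(s x, p x)) * (if k = 2 then (w s(s x, p' x) : ℝ) else 1 - w s(s x, p' x))) / (1 - θ x)
    else if k = 1 then 1 else 0 with hA
  set W₁ : Fin m → Fin m → Fin 3 := fun nn x => if x = i then (if q = p x then (1 : Fin 3) else 2) else if x = j then (if sJ = p x then (1 : Fin 3) else 2)
      else if x = nn then (if pK = p x then (1 : Fin 3) else 2) else 0 with hW₁
  set W₂ : Fin m → Fin m → Fin 3 := fun nn x => if x = i then (if pK = p x then (1 : Fin 3) else 2) else if x = j then (if q = p x then (1 : Fin 3) else 2)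
      else if x = nn then (if v = p x then (1 : Fin 3) else 2) else 0 with hW₂
  have hA0 : ∀ x, A x 0 = (if θ x < 1 then ((1 - (w s(s x, p x) : ℝ)) * (1 - w s(s x, p' x))) / (1 - θ x) else 0) := by
    intro x; simp only [hA]; simp
  change 8 * θ i * θ j * ∏ x, (if θ x < 1 then ((1 - (w s(s x, p x) : ℝ)) * (1 - w s(s x, p' x))) / (1 - θ x) else 0) ≤
    ∑ nn ∈ Nst, ((∏ x, A x (W₁ nn x)) + ∏ x, A x (W₂ nn x))
  rw [show (∏ x, (if θ x < 1 then ((1 - (w s(s x, p x) : ℝ)) * (1 - w s(s x, p' x))) / (1 - θ x) else 0)) = ∏ x, A x 0 from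
    prod_congr rfl fun x _ => (hA0 x).symm]
  -- hypotheses of `two_word_supply`
  have hθ0 : ∀ x, 0 ≤ θ x := fun x => mul_nonneg (w _).2.1 (w _).2.1
  have hθ1 : ∀ x, θ x ≤ 1 := fun x => mul_le_one₀ (w _).2.2 (w _).2.1 (w _).2.2
  have ha : ∀ x k, 0 ≤ A x k := fun x k => extremeCoeff_nonneg _ _ (w _).2.1 (w _).2.2 (w _).2.1 (w _).2.2 k
  have hgm : ∀ x, A x 0 ^ 2 * θ x ≤ A x 1 * A x 2 * (1 - Real.sqrt (θ x)) ^ 2 := by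
    intro x
    have h := extremeCoeff_one_mul_two (w s(s x, p x) : ℝ) (w s(s x, p' x)) (w _).2.1 (w _).2.2 (w _).2.1 (w _).2.2
    have h1 : A x 1 = (if θ x < 1 then ((w s(s x, p x) : ℝ) * (1 - w s(s x, p' x))) / (1 - θ x) else 1) := by simp only [hA]; simp
    have h2 : A x 2 = (if θ x < 1 then ((1 - (w s(s x, p x) : ℝ)) * w s(s x, p' x)) / (1 - θ x) else 0) := by simp only [hA]; simp
    rw [hA0, h1, h2]; exact h
  -- direction facts: the two words use both hairs of `i`, `j`, `nn`
  have hdir : ∀ (x : Fin m) (d d' : Fin n), ((p x = d ∧ p' x = d') ∨ (p x = d' ∧ p' x = d)) → d ≠ d' →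
      A x (if d = p x then (1 : Fin 3) else 2) * A x (if d' = p x then (1 : Fin 3) else 2) = A x 1 * A x 2 := by
    intro x d d' h hdd'
    rcases h with ⟨h1, h2⟩ | ⟨h1, h2⟩
    · rw [if_pos h1.symm, if_neg (fun h' => hdd' (h'.trans h1).symm)]
    · rw [if_neg (fun h' => hdd' (by rw [h', h1])), if_pos h1.symm, mul_comm]
  refine two_word_supply A θ ha hθ0 hθ1 hgm hij Nst hiN hjN hS W₁ W₂ ?_ ?_ ?_ ?_ ?_
  · intro nn _ x hxi hxj hxn; simp only [hW₁]; rw [if_neg hxi, if_neg hxj, if_neg hxn]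
  · intro nn _ x hxi hxj hxn; simp only [hW₂]; rw [if_neg hxi, if_neg hxj, if_neg hxn]
  · intro nn _
    simp only [hW₁, hW₂, if_true]
    exact hdir i q pK hpi hqK
  · intro nn hnn
    have hji : j ≠ i := hij.symm
    simp only [hW₁, hW₂, if_neg hji, if_true]
    rw [mul_comm]; exact hdir j q sJ hpj hqJ
  · intro nn hnn
    have hni : nn ≠ i := fun h => hiN (h ▸ hnn)
    have hnj : nn ≠ j := fun h => hjN (h ▸ hnn)
    simp only [hW₁, hW₂, if_neg hni, if_neg hnj, if_true]
    exact hdir nn pK v (hpn nn hnn) hKv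

end StarSet

end Summit.CriticalPhenomena.PercolationContinuityZ3.Theorems

end
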